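import Mathlib
import HarnessLib
import Summits.ValiantsHypothesis.ValiantsHypothesis.Theorems.LacunarySymmetroidMatrixDescartesProductPlusOneWronskianBudget
import Summits.ValiantsHypothesis.ValiantsHypothesis.Theorems.LacunarySymmetroidMatrixDescartesCensusLaguerreSum

/-!
# ValiantsHypothesis / LacunarySymmetroid — crux `MatrixDescartes` (stmt-ValiantsHypothesis-18050, V1),
# LINE (A) «product_plus_one»: ONE-CHANGE companies at EVERY `K` — the every-`K` floor is a budget on ONE polynomial

Every-`K` twin of ✓ `card_posRoots_eulerNumerator_le_wronskian_add_of_oneChange` (N2 + N3 of ✓ `…ProductPlusOneWronskianBudget`,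
which is `K = 3` only).  A row `f = Σ_l C a_l X^{d_l}` (any `K`, ANY support `d : Fin K → ℕ` — no monotonicity or injectivity) is
ONE-CHANGE when, along increasing exponents, its coefficient signs change at most once: either POSITIVES PERSIST UPWARD
(`d_l < d_{l'} → a_l > 0 → a_{l'} ≥ 0`; patterns `(−,…,−,+,…,+)`, `T1`) or NEGATIVES PERSIST UPWARD (`d_l < d_{l'} → a_l < 0 → a_{l'} ≤ 0`;
patterns `(+,…,+,−,…,−)`); for `K = 3` on `d 0 < d 1 < d 2` this is exactly «no strict dip» (types T1 / T4 / T5 and degenerations).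

* `countP_pos_roots_le_one_of_pos_persist` — Descartes for ONE sign change, for an ARBITRARY real polynomial: if the positive
  coefficients persist upward (`i < i' → Q_i > 0 → Q_{i'} ≥ 0`) then `Q` has at most ONE positive zero counted with multiplicity
  (two sign blocks ⇒ `V(Q) ≤ 1` by ✓ `Census.signVariations_succ_le_of_blocks`, then Mathlib's `roots_countP_pos_le_signVariations`);
  `countP_pos_roots_le_one_of_neg_persist` — the mirror (`Q ↦ −Q`).
* `fewnomial_coeff_pos_persist` / `fewnomial_coeff_neg_persist` — the row hypothesis on `(d, a)` transfers to the coefficients of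
  `Σ_l C a_l X^{d_l}` (colliding exponents allowed: a positive coefficient has a positive letter under it).
* `countP_pos_roots_fewnomial_le_one_of_oneChange` — a one-change row has at most one positive zero (with multiplicity);
  ★ `card_posRoots_prod_le_of_oneChangeK` — N3 at every `K`: a company of `m` one-change rows has `Z₊(∏_j f_j) ≤ m`.
* ★★ `card_posRoots_eulerNumerator_le_wronskian_add_of_oneChangeK` — every `K`, every support, EVERY coupling `l₀`:
  `Z₊(R_{l₀}) ≤ Z₊(W(P)) + 2m + 1` for one-change companies (`R_{l₀}` the c-free Euler numerator, `W(P) = P·θ²P − (θP)²`, ✓ N2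
  `card_posRoots_eulerNumerator_le_wronskian_add`).  So an every-`K` Wronskian budget `Z₊(W(∏ f_j)) ≤ C·(mK)^C` on one-change companies would
  give the one-change sector of `EulerBoundPoly` / `stub_polyLaw` at every coupling, exactly as EB2-W gives `OneChangeFloorK3` at `K = 3`.

HONEST FRAMING: counting frame + Descartes bookkeeping at every `K`; the Wronskian budget is NOT proved here (it is the research content);
closes NO stub by name; NOT `OneChangeFloorK3`, `EulerBoundK3`, `ClassRowK3Linear`, `PPOPolyLaw`, `ProductPlusOneMDR`, `MatrixDescartes`;
`VP ≠ VNP` is NOT proved and nothing here bears on it.  No definitions, no named facts, no sorry.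

[folklore] Descartes' rule of signs; no citation needed.
-/

set_option linter.dupNamespace false

namespace Summit.ValiantsHypothesis.ValiantsHypothesis.Theorems.LacunarySymmetroidMatrixDescartes

namespace ProductPlusOne

open Polynomial Finset
open scoped BigOperators

/-! ### §1 Descartes with ONE sign change, for an arbitrary real polynomial -/

/-- **Positives persist upward ⇒ at most one positive zero (with multiplicity).**  If `0 < Q.coeff i → 0 ≤ Q.coeff i'` whenever
`i < i'`, then `Q.roots.countP (0 < ·) ≤ 1`. [folklore] -/
theorem countP_pos_roots_le_one_of_pos_persist (Q : ℝ[X])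
    (h : ∀ i i' : ℕ, i < i' → 0 < Q.coeff i → 0 ≤ Q.coeff i') :
    Q.roots.countP (fun t => 0 < t) ≤ 1 := by
  classical
  by_cases hQ0 : Q = 0
  · rw [hQ0, roots_zero]; simp
  by_cases hex : ∃ i, 0 < Q.coeff i
  · -- two sign blocks: `[0, N)` non-positive, `[N, natDegree + 1)` non-negative, `N` = least positive coefficient
    set N := Nat.find hex with hN
    have hNpos : 0 < Q.coeff N := Nat.find_spec hex
    have hNle : N ≤ Q.natDegree := le_natDegree_of_ne_zero hNpos.ne'
    have hV : Q.signVariations + 1 ≤ 2 := by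
      refine Census.signVariations_succ_le_of_blocks 2 Q
        (fun k => if k = 0 then 0 else if k = 1 then N else Q.natDegree + 1) (if_pos rfl) ?_ ?_ ?_
      · refine monotone_nat_of_le_succ fun k => ?_
        rcases Nat.lt_or_ge k 2 with hk | hk
        · interval_cases k
          · simp
          · simp; omega
        · rw [if_neg (by omega), if_neg (by omega), if_neg (by omega), if_neg (by omega)]
      · simp
      · intro i hi
        interval_cases i
        · refine ⟨-1, Or.inr rfl, fun m _ hm => ?_⟩
          simp only [zero_add, one_ne_zero, if_false, if_true] at hm
          have hle : Q.coeff m ≤ 0 := by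
            by_contra hmpos
            push Not at hmpos
            exact (Nat.find_min hex hm) hmpos
          linarith
        · refine ⟨1, Or.inl rfl, fun m hm _ => ?_⟩
          simp only [one_ne_zero, if_false, if_true] at hm
          rw [one_mul]
          rcases hm.eq_or_lt with hmN | hmN
          · rw [← hmN]; exact hNpos.le
          · exact h N m hmN hNpos
    have hD := Q.roots_countP_pos_le_signVariations
    have e : Q.roots.countP (fun t => 0 < t) = Q.roots.countP (0 < ·) := rfl
    omega
  · -- no positive coefficient: `−Q` has non-negative coefficients, hence no positive zero
    push Not at hex
    have h0 : (-Q).roots.countP (fun t => 0 < t) = 0 :=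
      countP_pos_roots_eq_zero_of_coeff_nonneg (-Q) (fun i => by rw [coeff_neg]; linarith [hex i])
    rw [roots_neg] at h0
    omega

/-- **Negatives persist upward ⇒ at most one positive zero (with multiplicity)** (mirror of the previous lemma, `Q ↦ −Q`). [folklore] -/
theorem countP_pos_roots_le_one_of_neg_persist (Q : ℝ[X])
    (h : ∀ i i' : ℕ, i < i' → Q.coeff i < 0 → Q.coeff i' ≤ 0) :
    Q.roots.countP (fun t => 0 < t) ≤ 1 := by
  have h' := countP_pos_roots_le_one_of_pos_persist (-Q) (fun i i' hii' hi => by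
    rw [coeff_neg] at hi ⊢
    have := h i i' hii' (by linarith)
    linarith)
  rwa [roots_neg] at h'

/-! ### §2 One-change fewnomial rows -/

/-- Coefficients of a fewnomial `Σ_l C b_l X^{d_l}` (any support, collisions allowed). [folklore] -/
theorem coeff_fewnomial_eq_sum {K : ℕ} (d : Fin K → ℕ) (b : Fin K → ℝ) (i : ℕ) :
    (∑ l, C (b l) * X ^ (d l) : ℝ[X]).coeff i = ∑ l, (if i = d l then b l else 0) := by
  rw [finsetSum_coeff]
  exact Finset.sum_congr rfl fun l _ => by rw [coeff_C_mul_X_pow]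

/-- **Positives persist upward — from letters to coefficients**: if `d_l < d_{l'} → b_l > 0 → b_{l'} ≥ 0` then the coefficients of
`Σ_l C b_l X^{d_l}` have the same property. [folklore] -/
theorem fewnomial_coeff_pos_persist {K : ℕ} (d : Fin K → ℕ) (b : Fin K → ℝ)
    (h : ∀ l l', d l < d l' → 0 < b l → 0 ≤ b l') :
    ∀ i i' : ℕ, i < i' → 0 < (∑ l, C (b l) * X ^ (d l) : ℝ[X]).coeff i → 0 ≤ (∑ l, C (b l) * X ^ (d l) : ℝ[X]).coeff i' := by
  intro i i' hii' hi
  rw [coeff_fewnomial_eq_sum] at hi ⊢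
  -- some letter under `i` is positive
  obtain ⟨l₀, -, hl₀⟩ : ∃ l₀ ∈ (Finset.univ : Finset (Fin K)), 0 < (if i = d l₀ then b l₀ else 0) := by
    by_contra hno
    push Not at hno
    exact absurd (Finset.sum_nonpos hno) (not_le.mpr hi)
  have hil₀ : i = d l₀ := by
    by_contra hne; rw [if_neg hne] at hl₀; exact lt_irrefl _ hl₀
  rw [if_pos hil₀] at hl₀
  refine Finset.sum_nonneg fun l' _ => ?_
  split_ifs with hi'
  · exact h l₀ l' (by omega) hl₀
  · exact le_rfl

/-- **Negatives persist upward — from letters to coefficients.** [folklore] -/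
theorem fewnomial_coeff_neg_persist {K : ℕ} (d : Fin K → ℕ) (b : Fin K → ℝ)
    (h : ∀ l l', d l < d l' → b l < 0 → b l' ≤ 0) :
    ∀ i i' : ℕ, i < i' → (∑ l, C (b l) * X ^ (d l) : ℝ[X]).coeff i < 0 → (∑ l, C (b l) * X ^ (d l) : ℝ[X]).coeff i' ≤ 0 := by
  intro i i' hii' hi
  have hneg : (∑ l, C ((-b) l) * X ^ (d l) : ℝ[X]) = -(∑ l, C (b l) * X ^ (d l)) := by
    rw [← Finset.sum_neg_distrib]
    exact Finset.sum_congr rfl fun l _ => by simp [map_neg, neg_mul]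
  have h' := fewnomial_coeff_pos_persist d (-b) (fun l l' hll' hl => by
    simp only [Pi.neg_apply] at hl ⊢
    have := h l l' hll' (by linarith)
    linarith) i i' hii'
  rw [hneg, coeff_neg, coeff_neg] at h'
  have := h' (by linarith)
  linarith

/-- **A ONE-CHANGE row has at most one positive zero, with multiplicity** (every `K`, any support). [folklore] -/
theorem countP_pos_roots_fewnomial_le_one_of_oneChange {K : ℕ} (d : Fin K → ℕ) (b : Fin K → ℝ)
    (hone : (∀ l l', d l < d l' → 0 < b l → 0 ≤ b l') ∨ (∀ l l', d l < d l' → b l < 0 → b l' ≤ 0)) :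
    (∑ l, C (b l) * X ^ (d l) : ℝ[X]).roots.countP (fun t => 0 < t) ≤ 1 := by
  rcases hone with h | h
  · exact countP_pos_roots_le_one_of_pos_persist _ (fewnomial_coeff_pos_persist d b h)
  · exact countP_pos_roots_le_one_of_neg_persist _ (fewnomial_coeff_neg_persist d b h)

/-- ★ **N3 at every `K`: a company of `m` ONE-CHANGE rows has `Z₊(∏_j f_j) ≤ m`** (any support; so at most `m` poles of the Euler
ratio). [this file's theorem] -/
theorem card_posRoots_prod_le_of_oneChangeK {m K : ℕ} (d : Fin K → ℕ) (a : Fin m → Fin K → ℝ)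
    (hone : ∀ j, (∀ l l', d l < d l' → 0 < a j l → 0 ≤ a j l') ∨ (∀ l l', d l < d l' → a j l < 0 → a j l' ≤ 0)) :
    ((∏ j, ∑ l, C (a j l) * X ^ (d l) : ℝ[X]).roots.toFinset.filter (fun t => 0 < t)).card ≤ m := by
  classical
  by_cases hP : (∏ j, ∑ l, C (a j l) * X ^ (d l) : ℝ[X]) = 0
  · rw [hP, roots_zero, Multiset.toFinset_zero, Finset.filter_empty, Finset.card_empty]; exact Nat.zero_le _
  refine (StubVLawTwo.card_filter_pos_le_countP _).trans ?_
  rw [roots_prod _ _ hP, Multiset.countP_eq_card_filter, Multiset.filter_bind, Multiset.card_bind]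
  have hrow : ∀ j, ((∑ l, C (a j l) * X ^ (d l) : ℝ[X]).roots.filter (fun t => 0 < t)).card ≤ 1 := by
    intro j
    have h := countP_pos_roots_fewnomial_le_one_of_oneChange d (a j) (hone j)
    rwa [Multiset.countP_eq_card_filter] at h
  have hsum : (Multiset.map (Multiset.card ∘ fun j => Multiset.filter (fun t => 0 < t) (∑ l, C (a j l) * X ^ (d l) : ℝ[X]).roots)
          (Finset.univ : Finset (Fin m)).val).sum
      = ∑ j : Fin m, ((∑ l, C (a j l) * X ^ (d l) : ℝ[X]).roots.filter (fun t => 0 < t)).card := by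
    rw [Finset.sum_eq_multiset_sum]; rfl
  rw [hsum]
  calc ∑ j : Fin m, ((∑ l, C (a j l) * X ^ (d l) : ℝ[X]).roots.filter (fun t => 0 < t)).card
      ≤ ∑ _j : Fin m, 1 := Finset.sum_le_sum fun j _ => hrow j
    _ = m := by simp

/-! ### §3 The every-`K` floor as a budget on ONE polynomial -/

/-- ★★ **THE EVERY-`K` ONE-CHANGE FLOOR IS A BUDGET ON ONE POLYNOMIAL**: every `K`, any support `d`, EVERY coupling `l₀`, a company
of one-change rows: `Z₊(R_{l₀}) ≤ Z₊(W(∏_j f_j)) + 2m + 1`, where `R_{l₀} = Σ_j (Σ_l C(a_{jl}(d_l − d_{l₀})) X^{d_l})·∏_{i≠j} f_i`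
is the c-free Euler numerator and `W(P) = P·X(XP′)′ − (XP′)²`. [this file's theorem] -/
theorem card_posRoots_eulerNumerator_le_wronskian_add_of_oneChangeK {m K : ℕ} (d : Fin K → ℕ) (a : Fin m → Fin K → ℝ)
    (hone : ∀ j, (∀ l l', d l < d l' → 0 < a j l → 0 ≤ a j l') ∨ (∀ l l', d l < d l' → a j l < 0 → a j l' ≤ 0))
    (l₀ : Fin K) :
    ((∑ j, (∑ l, C (a j l * ((d l : ℝ) - d l₀)) * X ^ (d l)) * ∏ i ∈ Finset.univ.erase j, (∑ l, C (a i l) * X ^ (d l))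
        : ℝ[X]).roots.toFinset.filter (fun t => 0 < t)).card
      ≤ (((∏ j, ∑ l, C (a j l) * X ^ (d l) : ℝ[X]) * (X * derivative (X * derivative (∏ j, ∑ l, C (a j l) * X ^ (d l) : ℝ[X])))
            - (X * derivative (∏ j, ∑ l, C (a j l) * X ^ (d l) : ℝ[X])) ^ 2).roots.toFinset.filter (fun t => 0 < t)).card
        + 2 * m + 1 := by
  have h1 := card_posRoots_eulerNumerator_le_wronskian_add d a l₀
  have h2 := card_posRoots_prod_le_of_oneChangeK d a hone
  omega

/-- The `K = 3` dictionary: on `d 0 < d 1 < d 2`, «no strict dip» (`¬(a₀a₁ < 0 ∧ a₁a₂ < 0)`, the hypothesis of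
`OneChangeFloorK3`) implies the every-`K` one-change hypothesis. [folklore] -/
theorem oneChangeK_of_noStrictDip (d : Fin 3 → ℕ) (h01 : d 0 < d 1) (h12 : d 1 < d 2) (b : Fin 3 → ℝ)
    (hone : ¬ (b 0 * b 1 < 0 ∧ b 1 * b 2 < 0)) :
    (∀ l l' : Fin 3, d l < d l' → 0 < b l → 0 ≤ b l') ∨ (∀ l l' : Fin 3, d l < d l' → b l < 0 → b l' ≤ 0) := by
  by_cases hA : ∀ l l' : Fin 3, d l < d l' → 0 < b l → 0 ≤ b l'
  · exact Or.inl hA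
  right
  push Not at hA
  obtain ⟨l, l', hll', hl, hl'⟩ := hA
  have idx : ∀ k k' : Fin 3, d k < d k' → (k = 0 ∧ k' = 1) ∨ (k = 0 ∧ k' = 2) ∨ (k = 1 ∧ k' = 2) := by
    intro k k' h
    fin_cases k <;> fin_cases k' <;> simp at h ⊢ <;> omega
  intro k k' hkk' hk
  rcases idx l l' hll' with ⟨rfl, rfl⟩ | ⟨rfl, rfl⟩ | ⟨rfl, rfl⟩
  · -- `b 0 > 0 > b 1`: no strict dip forces `b 2 ≤ 0`
    have hb2 : b 2 ≤ 0 := by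
      by_contra h2
      push Not at h2
      exact hone ⟨mul_neg_of_pos_of_neg hl hl', mul_neg_of_neg_of_pos hl' h2⟩
    rcases idx k k' hkk' with ⟨rfl, rfl⟩ | ⟨rfl, rfl⟩ | ⟨rfl, rfl⟩
    · linarith
    · linarith
    · exact hb2
  · -- `b 0 > 0 > b 2`
    rcases idx k k' hkk' with ⟨rfl, rfl⟩ | ⟨rfl, rfl⟩ | ⟨rfl, rfl⟩
    · linarith
    · linarith
    · exact hl'.le
  · -- `b 1 > 0 > b 2`: no strict dip forces `b 0 ≥ 0`
    rcases idx k k' hkk' with ⟨rfl, rfl⟩ | ⟨rfl, rfl⟩ | ⟨rfl, rfl⟩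
    · exact absurd ⟨mul_neg_of_neg_of_pos hk hl, mul_neg_of_pos_of_neg hl hl'⟩ hone
    · exact hl'.le
    · linarith

end ProductPlusOne

end Summit.ValiantsHypothesis.ValiantsHypothesis.Theorems.LacunarySymmetroidMatrixDescartes
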